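import Literature.NumberTheory.EllipticCurves.BSDLowerBoundLayersProofs

/-!
# The upper-bound half of rank-BSD is layered by the algebraic rank; its lowest open layer is "analytic rank two ⟹ rank ≤ 2"

Write `a = ord_{s=1} L(E,s)` (`analyticRank`) and `r = rank E(ℚ)` (`mordellWeilRank`).  Over
Gross–Zagier–Kolyvagin (`rank_eq_analyticRank_of_analyticRank_le_one`: `a ≤ 1 ⟹ r = a ∧ Ш finite`)
the rank conjecture `∀ E/ℚ, a = r` is the conjunction of two walls
(`forall_analyticRank_eq_rank_iff_upper_and_lower`): the LOWER bound `a ≥ 2 ⟹ a ≤ r` (treated in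
`BSDLowerBoundLayersProofs`: its layers `a ≥ k ⟹ r ≥ k` start at `k = 2`, and the two lowest are
finiteness-of-`Ш` statements in rank `0` and rank `≤ 1`) and the UPPER bound `r ≥ 3 ∧ a ≥ 2 ⟹ r ≤ a`.
This companion file records the symmetric bookkeeping for the upper wall:

* `le_analyticRank_of_le_rank_of_le_two` — the layers `r ≥ k ⟹ a ≥ k` for `k ≤ 2` are theorems
  (contrapositives of GZK);
* `three_le_analyticRank_of_three_le_rank_iff` (per curve) and
  `forall_three_le_analyticRank_of_three_le_rank_iff` —
  `(∀ E, r ≥ 3 → a ≥ 3) ↔ (∀ E, a = 2 → r ≤ 2)`: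
  **the lowest open layer of the upper wall is exactly the Mordell–Weil form of a "rank-two
  Kolyvagin theorem": every `E/ℚ` whose `L`-function vanishes to order exactly two at `s = 1` has
  at most two independent rational points**; in particular this layer does NOT contain the parity
  statement `r = 3 ⟹ a odd` (which needs in addition the layer `a ≥ 4 ⟹ r ≥ 4` of the lower wall,
  `analyticRank_eq_three_of_rank_eq_three`);
* `le_analyticRank_of_le_rank_iff` / `forall_le_analyticRank_of_le_rank_iff` — the general layer:
  `(∀ E, r ≥ k → a ≥ k) ↔ (∀ E, 2 ≤ a < k → r < k)`;
* `forall_upperBoundDeep_iff_forall_layers` / `forall_upperBoundDeep_iff_forall_exact_layers` —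
  the upper wall is the conjunction of its layers, equivalently of the "exact" layers
  `a = k ⟹ r ≤ k` (`k ≥ 2`);
* `forall_analyticRank_eq_rank_iff_walls_layered` — over GZK, `(∀ E, a = r)` is the conjunction of
  ALL layers of both walls: `(∀ k E, a ≥ k → r ≥ k) ∧ (∀ k E, r ≥ k → a ≥ k)`, of which exactly the
  layers `k ≥ 2` of the first and `k ≥ 3` of the second are open.

So the two walls have symmetric bottoms: the lower wall starts with "`a ≥ 2 ⟹ r ≥ 1`" (⟺ `Ш(E)`
finite for every `E` of rank `0`, `forall_one_le_rank_of_two_le_analyticRank_iff`), the upper wall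
with "`a = 2 ⟹ r ≤ 2`".  Nothing here is deep; every proof is case analysis over GZK.

References: B. Gross, D. Zagier, Invent. Math. 84 (1986), Thm. I.6.3; V. Kolyvagin, in: The
Grothendieck Festschrift II, Progr. Math. 87 (1990); H. Darmon, *Rational points on modular elliptic
curves*, CBMS 101 (2004), Thm. 3.22 (the combined statement `a ≤ 1 ⟹ r = a ∧ #Ш < ∞`).
-/

open scoped Classical
open WeierstrassCurve Literature.NumberTheory.EllipticCurves.ModularForms

namespace Literature.NumberTheory.EllipticCurves

/-! ### Per curve -/

section PerCurve

variable (W : WeierstrassCurve ℚ) [hE : W.IsElliptic]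

/-- **The free layers.** Over GZK, `r ≥ k ⟹ a ≥ k` for `k ≤ 2` (if `a ≤ 1` then `r = a`).
[cite: Darmon2004, Thm. 3.22] -/
theorem le_analyticRank_of_le_rank_of_le_two (hGZK : rank_eq_analyticRank_of_analyticRank_le_one)
    {k : ℕ} (hk : k ≤ 2) (hr : k ≤ W.mordellWeilRank) : k ≤ W.analyticRank := by
  by_contra ha
  have h := (hGZK W (by omega)).1
  omega

/-- **Lowest open layer of the upper wall, per curve.** Over GZK:
`(r ≥ 3 → a ≥ 3) ↔ (a = 2 → r ≤ 2)` for the curve at hand (if `r ≥ 3` and `a ≤ 2` then `a ≤ 1`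
would give `r = a ≤ 1`, so `a = 2`). [cite: Darmon2004, Thm. 3.22] -/
theorem three_le_analyticRank_of_three_le_rank_iff
    (hGZK : rank_eq_analyticRank_of_analyticRank_le_one) :
    (3 ≤ W.mordellWeilRank → 3 ≤ W.analyticRank) ↔
      (W.analyticRank = 2 → W.mordellWeilRank ≤ 2) := by
  constructor
  · intro h ha
    by_contra hr
    have h3 := h (by omega)
    omega
  · intro h hr
    by_contra ha
    by_cases ha1 : W.analyticRank ≤ 1
    · have h1 := (hGZK W ha1).1
      omega
    · have h2 := h (by omega)
      omega

/-- **General layer of the upper wall, per curve.** Over GZK, for every `k`: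
`(r ≥ k → a ≥ k) ↔ (2 ≤ a → a < k → r < k)`. [cite: Darmon2004, Thm. 3.22] -/
theorem le_analyticRank_of_le_rank_iff (hGZK : rank_eq_analyticRank_of_analyticRank_le_one)
    (k : ℕ) :
    (k ≤ W.mordellWeilRank → k ≤ W.analyticRank) ↔
      (2 ≤ W.analyticRank → W.analyticRank < k → W.mordellWeilRank < k) := by
  constructor
  · intro h _ hak
    by_contra hr
    have hk := h (by omega)
    omega
  · intro h hr
    by_contra ha
    by_cases ha1 : W.analyticRank ≤ 1
    · have h1 := (hGZK W ha1).1
      omega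
    · have h2 := h (by omega) (by omega)
      omega

omit hE in
/-- **Rank three.** Over GZK, `a = r` for a curve of rank `3` is the conjunction of the layer
`r ≥ 3 ⟹ a ≥ 3` of the upper wall and the layer `a ≥ 4 ⟹ r ≥ 4` of the lower wall at that curve;
in particular Mordell–Weil parity in rank `3` (`r = 3 ⟹ a` odd) is not contained in the upper
layer alone. [cite: Darmon2004, Thm. 3.22] -/
theorem analyticRank_eq_three_of_rank_eq_three (hr : W.mordellWeilRank = 3)
    (hup : 3 ≤ W.mordellWeilRank → 3 ≤ W.analyticRank)
    (hlow : 4 ≤ W.analyticRank → 4 ≤ W.mordellWeilRank) : W.analyticRank = 3 := by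
  have h3 := hup (by omega)
  by_contra ha
  have h4 := hlow (by omega)
  omega

end PerCurve

/-! ### Universal forms -/

section Universal

/-- **The lowest open layer of the upper wall is "analytic rank two ⟹ rank ≤ 2".** Over GZK:
`(∀ E/ℚ, rank E(ℚ) ≥ 3 ⟹ ord_{s=1} L(E,s) ≥ 3) ↔ (∀ E/ℚ, ord_{s=1} L(E,s) = 2 ⟹ rank E(ℚ) ≤ 2)`.
The right-hand side is the Mordell–Weil shadow of a rank-two analogue of Kolyvagin's theorem
(`ord = 2 ⟹ corank Sel_{p^∞} ≤ 2` would give it); no such theorem is known.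
[cite: Darmon2004, Thm. 3.22] [cite: GrossZagier1986, Thm. I.6.3] -/
theorem forall_three_le_analyticRank_of_three_le_rank_iff
    (hGZK : rank_eq_analyticRank_of_analyticRank_le_one) :
    (∀ W : WeierstrassCurve ℚ, W.IsElliptic → 3 ≤ W.mordellWeilRank → 3 ≤ W.analyticRank) ↔
      (∀ W : WeierstrassCurve ℚ, W.IsElliptic → W.analyticRank = 2 → W.mordellWeilRank ≤ 2) := by
  constructor
  · intro h W hE
    exact (three_le_analyticRank_of_three_le_rank_iff W hGZK).1 (h W hE)
  · intro h W hE
    exact (three_le_analyticRank_of_three_le_rank_iff W hGZK).2 (h W hE)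

/-- **General layer, universally.** Over GZK, for every `k`:
`(∀ E, rank ≥ k ⟹ ord ≥ k) ↔ (∀ E, 2 ≤ ord < k ⟹ rank < k)`. [cite: Darmon2004, Thm. 3.22] -/
theorem forall_le_analyticRank_of_le_rank_iff
    (hGZK : rank_eq_analyticRank_of_analyticRank_le_one) (k : ℕ) :
    (∀ W : WeierstrassCurve ℚ, W.IsElliptic → k ≤ W.mordellWeilRank → k ≤ W.analyticRank) ↔
      (∀ W : WeierstrassCurve ℚ, W.IsElliptic → 2 ≤ W.analyticRank → W.analyticRank < k →
        W.mordellWeilRank < k) := by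
  constructor
  · intro h W hE
    exact (le_analyticRank_of_le_rank_iff W hGZK k).1 (h W hE)
  · intro h W hE
    exact (le_analyticRank_of_le_rank_iff W hGZK k).2 (h W hE)

/-- **The upper wall is the conjunction of its layers.** Over GZK:
`(∀ E, rank ≥ 3 → ord ≥ 2 → rank ≤ ord) ↔ (∀ k E, rank ≥ k → ord ≥ k)` (the layers `k ≤ 2` being
free, `le_analyticRank_of_le_rank_of_le_two`). [cite: Darmon2004, Thm. 3.22] -/
theorem forall_upperBoundDeep_iff_forall_layers
    (hGZK : rank_eq_analyticRank_of_analyticRank_le_one) :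
    (∀ W : WeierstrassCurve ℚ, W.IsElliptic → 3 ≤ W.mordellWeilRank → 2 ≤ W.analyticRank →
        W.mordellWeilRank ≤ W.analyticRank) ↔
      (∀ k : ℕ, ∀ W : WeierstrassCurve ℚ, W.IsElliptic → k ≤ W.mordellWeilRank →
        k ≤ W.analyticRank) := by
  constructor
  · intro h k W hE hk
    by_cases hk2 : k ≤ 2
    · exact le_analyticRank_of_le_rank_of_le_two W hGZK hk2 hk
    · have h2 : 2 ≤ W.analyticRank :=
        le_analyticRank_of_le_rank_of_le_two W hGZK le_rfl (by omega)
      have h' := h W hE (by omega) h2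
      omega
  · intro h W hE _ _
    exact h W.mordellWeilRank W hE le_rfl

/-- **Equivalently, of its exact layers `ord = k ⟹ rank ≤ k` (`k ≥ 2`)** (pure logic, no
hypothesis): `(∀ E, rank ≥ 3 → ord ≥ 2 → rank ≤ ord) ↔ (∀ k ≥ 2, ∀ E, ord = k → rank ≤ k)`; the
case `k = 2` is the lowest open layer (`forall_three_le_analyticRank_of_three_le_rank_iff`).
[cite: Darmon2004, Thm. 3.22] -/
theorem forall_upperBoundDeep_iff_forall_exact_layers :
    (∀ W : WeierstrassCurve ℚ, W.IsElliptic → 3 ≤ W.mordellWeilRank → 2 ≤ W.analyticRank →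
        W.mordellWeilRank ≤ W.analyticRank) ↔
      (∀ k : ℕ, 2 ≤ k → ∀ W : WeierstrassCurve ℚ, W.IsElliptic → W.analyticRank = k →
        W.mordellWeilRank ≤ k) := by
  constructor
  · intro h k hk W hE hak
    by_cases hr : W.mordellWeilRank ≤ 2
    · omega
    · have h' := h W hE (by omega) (by omega)
      omega
  · intro h W hE _ ha
    exact h W.analyticRank ha W hE rfl

/-- **Rank-BSD as the conjunction of all layers of both walls.** Over GZK:
`(∀ E, ord = rank) ↔ (∀ k E, ord ≥ k → rank ≥ k) ∧ (∀ k E, rank ≥ k → ord ≥ k)`; by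
`BSDLowerBoundLayersProofs` and the present file the open layers are exactly `k ≥ 2` on the left
(the two lowest being `Ш`-finiteness in rank `0` and in rank `≤ 1`) and `k ≥ 3` on the right (the
lowest being "`ord = 2 ⟹ rank ≤ 2`").  (This particular equivalence is pure logic.)
[cite: Darmon2004, Thm. 3.22] -/
theorem forall_analyticRank_eq_rank_iff_walls_layered :
    (∀ W : WeierstrassCurve ℚ, W.IsElliptic → W.analyticRank = W.mordellWeilRank) ↔
      (∀ k : ℕ, ∀ W : WeierstrassCurve ℚ, W.IsElliptic → k ≤ W.analyticRank →
          k ≤ W.mordellWeilRank) ∧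
      (∀ k : ℕ, ∀ W : WeierstrassCurve ℚ, W.IsElliptic → k ≤ W.mordellWeilRank →
          k ≤ W.analyticRank) := by
  constructor
  · intro h
    exact ⟨fun k W hE hk => by rw [← h W hE]; exact hk, fun k W hE hk => by rw [h W hE]; exact hk⟩
  · rintro ⟨hlow, hup⟩ W hE
    exact le_antisymm (hlow _ W hE le_rfl) (hup _ W hE le_rfl)

/-- **The two symmetric bottoms.** Over GZK and the rank-zero `p`-converse (modularity, Mazur's
main conjecture à la Burungale–Castella–Skinner, Perrin-Riou–Schneider): the lowest open layer of
the lower wall is `Ш(E)` finite for every `E/ℚ` of rank `0`, and the lowest open layer of the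
upper wall is `ord_{s=1} L(E,s) = 2 ⟹ rank E(ℚ) ≤ 2` for every `E/ℚ`; i.e.
`((∀ E, ord ≥ 2 → rank ≥ 1) ∧ (∀ E, rank ≥ 3 → ord ≥ 3)) ↔
 ((∀ E, rank = 0 → Ш(E) finite) ∧ (∀ E, ord = 2 → rank ≤ 2))`.
[cite: GreenbergLNM1716, §1 pp. 65–66 and Thm. 4.1] [cite: BurungaleCastellaSkinner2025, Thm. 1.1.2 (a)]
[cite: Darmon2004, Thm. 3.22] -/
theorem forall_bottomLayers_iff
    (hGZK : rank_eq_analyticRank_of_analyticRank_le_one)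
    (hmod : exists_isNewformOf) (hMC : burungale_castella_skinner_charIdeal_eq_padicLFunction)
    (hS : Schneider1985_order_charGenerator) :
    ((∀ W : WeierstrassCurve ℚ, W.IsElliptic → 2 ≤ W.analyticRank → 1 ≤ W.mordellWeilRank) ∧
      (∀ W : WeierstrassCurve ℚ, W.IsElliptic → 3 ≤ W.mordellWeilRank → 3 ≤ W.analyticRank)) ↔
    ((∀ W : WeierstrassCurve ℚ, W.IsElliptic → W.mordellWeilRank = 0 → Finite W.sha) ∧
      (∀ W : WeierstrassCurve ℚ, W.IsElliptic → W.analyticRank = 2 → W.mordellWeilRank ≤ 2)) :=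
  Iff.and (forall_one_le_rank_of_two_le_analyticRank_iff hGZK hmod hMC hS)
    (forall_three_le_analyticRank_of_three_le_rank_iff hGZK)

end Universal

end Literature.NumberTheory.EllipticCurves
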